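import Summits.ResolutionOfSingularities.ResolutionOfSingularities.Theorems.WeightedInvariantWeightedThesisHypersurfaceModelProjection
import Mathlib.AlgebraicGeometry.IdealSheaf.Functorial
import HarnessLib

/-!
# `EquisingularLift.HypersurfacesSuffice` (crux stmt-ResolutionOfSingularities-15964), line
# `generic-projection-closure`, stub S2: the image ideal is locally principal off the vertex

For `X` integral of dimension `d` and a finite morphism `φ₀ : X → ℙ^{d+1}_k` avoiding the vertex
`(0 : … : 0 : 1)`, the kernel of `φ₀^*` (the ideal of the scheme-theoretic image) is principal on an
affine neighbourhood of every point `y ≠ vertex`: `φ₀` factors through the punctured space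
`ℙ^{d+1} ∖ {vertex}` (`φ₀ = φ_Y ≫ ι`), where the landed chart computation
`HypersurfaceModel.exists_ker_ideal_isPrincipal` (minimal polynomial over the integrally closed
coordinate ring of a chart of `ℙ^d`, the projection from the vertex `pr ∘ φ_Y : X → ℙ^d` being
finite surjective) gives an affine `W ∋ y` of the punctured space with `ker φ_Y^*|_W` principal; the
kernel ideal sheaf of `φ₀` on the affine `ι(W)` of `ℙ^{d+1}` corresponds to that of `φ_Y` on `W`
under `Γ(ℙ^{d+1}, ι(W)) ≅ Γ(ℙ^{d+1} ∖ {vertex}, W)`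
(Mathlib `Scheme.ker_ideal_of_isPullback_of_isOpenImmersion` for the cartesian square
`φ_Y, 𝟙_X, ι, φ₀`). [Hartshorne 1977, I Prop. 4.9 (proof)]
-/

noncomputable section

set_option linter.dupNamespace false -- mandated namespace of this single-conjunct summit

open CategoryTheory CategoryTheory.Limits AlgebraicGeometry TopologicalSpace
open Literature.AlgebraicGeometry.Resolution Literature.AlgebraicGeometry.Motives
open Literature.AlgebraicGeometry.Motives.Segre (toSpec)
open Summit.ResolutionOfSingularities.ResolutionOfSingularities.Theorems.WeightedThesis

namespace Summit.ResolutionOfSingularities.ResolutionOfSingularities.Theorems.HypersurfacesSuffice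

/-- An ideal whose preimage under a surjective ring map is principal is principal. [folklore] -/
theorem isPrincipal_of_comap_of_surjective {R S : Type*} [CommRing R] [CommRing S] (f : R →+* S)
    (hf : Function.Surjective f) (I : Ideal S) (h : (I.comap f).IsPrincipal) : I.IsPrincipal := by
  obtain ⟨g, hg⟩ := h.principal
  refine ⟨⟨f g, ?_⟩⟩
  rw [← Ideal.map_comap_of_surjective f hf I]
  change Ideal.map f (Ideal.comap f I) = Ideal.span {f g}
  rw [hg]
  change Ideal.map f (Ideal.span {g}) = Ideal.span {f g}
  rw [Ideal.map_span, Set.image_singleton]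

/-- **S2 — the image ideal is locally principal off the vertex.** For `X` integral of dimension
`d` and `φ₀ : X → ℙ^{d+1}_k` finite avoiding the vertex, every point `y ≠ vertex` of `ℙ^{d+1}` has
an affine neighbourhood on which the kernel of `φ₀^*` is principal (a chart `D₊(x_i)`, `i ≤ d`, of
the punctured space, where it is generated by a minimal polynomial).
[cite: Hartshorne1977, I Prop. 4.9 (proof)] -/
theorem stub_ker_isPrincipal_of_ne_vertex : ∀ (d : ℕ) (k : Type) [Field k] (X : AlgebraicGeometry.Scheme.{0}) [AlgebraicGeometry.IsIntegral X] (φ₀ : X ⟶ Literature.AlgebraicGeometry.Morphisms.ProjCech.PP k (d + 1)) [AlgebraicGeometry.IsFinite φ₀], (∀ x : X, φ₀ x ≠ Literature.AlgebraicGeometry.Resolution.DeJong1996.vertex d k) → topologicalKrullDim X = d → ∀ y : Literature.AlgebraicGeometry.Morphisms.ProjCech.PP k (d + 1), y ≠ Literature.AlgebraicGeometry.Resolution.DeJong1996.vertex d k → ∃ U : (Literature.AlgebraicGeometry.Morphisms.ProjCech.PP k (d + 1)).affineOpens, y ∈ (U : (Literature.AlgebraicGeometry.Morphisms.ProjCech.PP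 k (d + 1)).Opens) ∧ (φ₀.ker.ideal U).IsPrincipal := by
  intro d k _ X _ φ₀ _ hv hdim y hy
  -- `φ₀` factors through the punctured space `Y = ℙ^{d+1} ∖ {vertex}`
  have hrange : Set.range φ₀ ⊆ Set.range (DeJong1996.puncturedSpace d k).ι := by
    rintro _ ⟨x, rfl⟩
    rw [Scheme.Opens.range_ι, DeJong1996.coe_puncturedSpace]
    exact hv x
  set φY := IsOpenImmersion.lift (DeJong1996.puncturedSpace d k).ι φ₀ hrange with hφY
  have hfac : φY ≫ (DeJong1996.puncturedSpace d k).ι = φ₀ := IsOpenImmersion.lift_fac _ _ _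
  have hpb : IsPullback φY (𝟙 X) (DeJong1996.puncturedSpace d k).ι φ₀ :=
    IsOpenImmersion.isPullback_lift_id _ _ hrange
  -- `φ_Y` is finite, and `pr ∘ φ_Y : X → ℙ^d` is finite (proper and affine) and surjective
  haveI : IsFinite (φY ≫ (DeJong1996.puncturedSpace d k).ι) := by rw [hfac]; infer_instance
  haveI : IsFinite φY := IsFinite.of_comp φY (DeJong1996.puncturedSpace d k).ι
  obtain ⟨-, -, hpr⟩ := HypersurfaceModel.smooth_isSeparated_isProper_toSpec k (d + 1)
  obtain ⟨-, hsep', -⟩ := HypersurfaceModel.smooth_isSeparated_isProper_toSpec k d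
  haveI := hpr
  haveI := hsep'
  haveI := HypersurfaceModel.isAffineHom_vertexProjection d k
  haveI : IsAffineHom (φY ≫ DeJong1996.vertexProjection d k) := inferInstance
  have hover : (φY ≫ DeJong1996.vertexProjection d k) ≫ toSpec (Fin (d + 1)) k =
      φ₀ ≫ toSpec (Fin (d + 1 + 1)) k := by
    rw [Category.assoc, DeJong1996.vertexProjection_toSpec, ← Category.assoc, hfac]
  haveI : IsProper ((φY ≫ DeJong1996.vertexProjection d k) ≫ toSpec (Fin (d + 1)) k) := by
    rw [hover]; infer_instance
  haveI : IsProper (φY ≫ DeJong1996.vertexProjection d k) :=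
    IsProper.of_comp (φY ≫ DeJong1996.vertexProjection d k) (toSpec (Fin (d + 1)) k)
  haveI : IsFinite (φY ≫ DeJong1996.vertexProjection d k) :=
    IsFinite.iff_isProper_and_isAffineHom.2 ⟨inferInstance, inferInstance⟩
  haveI : Surjective (φY ≫ DeJong1996.vertexProjection d k) :=
    surjective_of_isFinite_of_dim (φY ≫ DeJong1996.vertexProjection d k) hdim
  -- the chart computation in the punctured space, around `y`
  have hyY : y ∈ DeJong1996.puncturedSpace d k := (DeJong1996.mem_puncturedSpace_iff d k y).2 hy
  obtain ⟨W, hyW, hW⟩ := HypersurfaceModel.exists_ker_ideal_isPrincipal d k φY ⟨y, hyY⟩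
  refine ⟨⟨(DeJong1996.puncturedSpace d k).ι ''ᵁ (W : (DeJong1996.puncturedSpace d k : Scheme.{0}).Opens),
    W.2.image_of_isOpenImmersion _⟩, ⟨⟨y, hyY⟩, hyW, rfl⟩, ?_⟩
  -- transport along `Γ(ℙ^{d+1}, ι(W)) ≅ Γ(Y, W)`
  have key := Scheme.ker_ideal_of_isPullback_of_isOpenImmersion φ₀ φY (𝟙 X)
    (DeJong1996.puncturedSpace d k).ι hpb W
  rw [key] at hW
  exact isPrincipal_of_comap_of_surjective _
    (ConcreteCategory.bijective_of_isIso ((DeJong1996.puncturedSpace d k).ι.appIso _).inv).2 _ hW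

end Summit.ResolutionOfSingularities.ResolutionOfSingularities.Theorems.HypersurfacesSuffice

end
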